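/-
Origin: expansion seat `planner-pub-hodgecm-mc-axioms-1-g14-0`, handover #W127 2026-08-20T15:53:55Z md5 7b107ff34a65 (PKG 53e78c09e51c → 7b107ff34a65; 158 l.; MECHANICAL (iib-R) rewrite v3.1 of the PKG file as it stands (8 token edits; rules R1x2+RX[h₂']x6)) (`HOME/mc/pub-hodgecm-mc-axioms-1-g14/revendor/kit-r55/stage55/HodgeCM/Model/ArchKTypeOfLineSupplyPin.lean`, md5 7b107ff34a65, 158 lines);
landed by the gen-22 packager (p-g22) in gate run 55 REPLACES the earlier landed copy of `HodgeCM/Model/ArchKTypeOfLineSupplyPin.lean` (seat copy carried the packager Origin header of an earlier run (stripped)).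
-/
/-
Copyright (c) 2026. Released under Apache 2.0 license as described in the file LICENSE.
Cell pub-hodgecm, MODEL layer (construction prover mc-carch-1, gen 5), BINDER-OWNERS rows 12 / 14 / 15 / 17 AT THE CONSTRUCTED PIN R2:
row 17's (W-0-supply) at sinst-1's `SROGT'C` / `SROGT'CJ` (#1229), hypothesis-free under E's guard.
-/
import Summits.HodgeConjecture.HodgeCM.Model.ArchKTypeOfLineSupplyR2
import Summits.HodgeConjecture.HodgeCM.Model.ThetaAdelicSideR2

/-!
# (W-0-supply) at the CONSTRUCTED pin R2: `SInstance.hsupply_two_three_ROGT'C`, `…_ROGT'CJ`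

sinst-1 #1229 `ThetaAdelicSideR2` builds E's pin R2 `SInstance.SROGT'C @hGR @hGR₀ @hGR₁ @hGR₂ @hGR₃ @μ hΔ₁ hΔ₂ hΔ₃ : ∀ V c, ThetaAdelicSide V c` (and its
(J-μ)-closed form `SROGT'CJ`) over carch #CA55's second twist `ν'R`, with `SROGT'C_eq_archSideOfT' (hc : GOG V c)`.  Composing with #CA57
(`hsupply_two_three_of_side_eq` at `e := SROGT'C_eq_archSideOfT' hc ⬝ archSideOfT'_R2_eq_archSideOfChar`) gives binder-1's row-17 `hsupply` TEXT
(#56 `Real34CensusSideT.ofCensus` :192) AT THE PIN ITSELF: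

* **`SInstance.hsupply_two_three_ROGT'C (hΔ₁ hΔ₂ hΔ₃) (V c) (hc : GOG V c) (hV)`** — at `thetaSpaceInputIn … (SROGT'C … V c) hV`;
* **`SInstance.hsupply_two_three_ROGT'CJ (V c) (hc : GOG V c) (hV)`** — at `thetaSpaceInputIn … (SROGT'CJ @hGR @hGR₀ @hGR₁ @hGR₂ @hGR₃ @μ V c) hV`,
  pin inputs hGR×5 [GR91 3.1.1] and `μ` only, NO PROVE input, NO hypothesis beyond the guard `GOG V c`.

So for the R2 child of E (glue-1) the `hsupply` argument of binder-1's socket — once that socket is typed at a general side / at this pin — is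
ONE term.  0 records, 0 `def … : Prop`, nothing cited as a hypothesis.
-/

set_option autoImplicit false

noncomputable section

open NumberField NumberField.InfinitePlace NumberField.mixedEmbedding IsDedekindDomain
open scoped Matrix TensorProduct Classical SchwartzMap
open MulAction
open Literature.Geometry.ComplexHyperbolic.BallModel (U21 x₀ stabilizerEquivK21)
open Literature.NumberTheory.Automorphic.U21 (K21 matA sclD)
open Literature.AlgebraicGeometry.HodgeTheory
open Literature.AlgebraicGeometry.ShimuraVarieties Literature.AlgebraicGeometry.ShimuraVarieties.BallForms
open Literature.NumberTheory.Automorphic Literature.NumberTheory.Automorphic.UnitaryGroup Literature.NumberTheory.Weil1964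
open Literature.RepresentationTheory.KonnoKonno2007 Literature.RepresentationTheory.KonnoKonno2007.RealDualPair
open Literature.NumberTheory.GelbartRogawski1991 Literature.NumberTheory.GelbartRogawski1991.UnitaryDualPair
open Literature.Analysis.SegalBargmann Literature.Analysis.Distribution
open Literature.NumberTheory.Automorphic.PicardCM
open HodgeCM.Adelic HodgeCM.PerL34 HodgeCM.Model.HypCensus HodgeCM.Model.SupplyInstance HodgeCM.Model.ArchSideTerm

namespace HodgeCM.Model.SInstance

variable (hHD : exists_isReal_hodgeModel) (hI : hodgePQ_independent_of_hodgeModel)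
  (h₁ : BallQuotientUniformised)  (h₃ : CMAbelianVarietyRealised)

variable
  (hGR : ∀ {L : CMField} {ι₁ : L →+* ℂ} (V : HermSpace3 L ι₁) (c : SeesawCtx L),
    (cmSplittingDatum (L : Type) finProdFinEquiv (frameD V) (frameD_real V) (frameD_ne V) (dW c.D) (dW_real c.D)
      (dW_ne c.D)).CompatibleSplitting)
  (hGR₀ : ∀ {L : CMField} {ι₁ : L →+* ℂ} (V : HermSpace3 L ι₁) (c : SeesawCtx L),
    (cmSplittingDatum (L : Type) (ArchSideTerm.e₁) (frameD V) (frameD_real V) (frameD_ne V) (lineVec (L : Type) (dW c.D 0))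
      (fun _ => dW_real c.D 0) (fun _ => dW_ne c.D 0)).CompatibleSplitting)
  (hGR₁ : ∀ {L : CMField} {ι₁ : L →+* ℂ} (V : HermSpace3 L ι₁) (c : SeesawCtx L),
    (cmSplittingDatum (L : Type) (ArchSideTerm.e₁) (frameD V) (frameD_real V) (frameD_ne V) (lineVec (L : Type) (dW c.D 1))
      (fun _ => dW_real c.D 1) (fun _ => dW_ne c.D 1)).CompatibleSplitting)
  (hGR₂ : ∀ {L : CMField} {ι₁ : L →+* ℂ} (V : HermSpace3 L ι₁) (c : SeesawCtx L),
    (cmSplittingDatum (L : Type) (ArchSideTerm.e₁) (frameD V) (frameD_real V) (frameD_ne V) (lineVec (L : Type) (dW' c.D 0))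
      (fun _ => dW'_real c.D 0) (fun _ => dW'_ne c.D 0)).CompatibleSplitting)
  (hGR₃ : ∀ {L : CMField} {ι₁ : L →+* ℂ} (V : HermSpace3 L ι₁) (c : SeesawCtx L),
    (cmSplittingDatum (L : Type) (ArchSideTerm.e₁) (frameD V) (frameD_real V) (frameD_ne V) (lineVec (L : Type) (dW' c.D 1))
      (fun _ => dW'_real c.D 1) (fun _ => dW'_ne c.D 1)).CompatibleSplitting)
  (μ : ∀ {L : CMField}, SeesawCtx L → Fin 4 → NumberField.InfinitePlace (L : Type) → ℤ)
  (hΔ₁ : ∀ {L : CMField} {ι₁ : L →+* ℂ} (V : HermSpace3 L ι₁) (c : SeesawCtx L), ∀ hc : GOG V c,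
    slotTypeVec V c (hGR V c) (hGR₀ V c) (hGR₁ V c) (hGR₂ V c) (hGR₃ V c) (hG_GOG V c hc) 1 -
      slotTypeVec V c (hGR V c) (hGR₀ V c) (hGR₁ V c) (hGR₂ V c) (hGR₃ V c) (hG_GOG V c hc) 0 = μ c 1 - μ c 0)
  (hΔ₂ : ∀ {L : CMField} {ι₁ : L →+* ℂ} (V : HermSpace3 L ι₁) (c : SeesawCtx L), ∀ hc : GOG V c,
    slotTypeVec V c (hGR V c) (hGR₀ V c) (hGR₁ V c) (hGR₂ V c) (hGR₃ V c) (hG_GOG V c hc) 2 -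
      slotTypeVec V c (hGR V c) (hGR₀ V c) (hGR₁ V c) (hGR₂ V c) (hGR₃ V c) (hG_GOG V c hc) 0 = μ c 2 - μ c 0)
  (hΔ₃ : ∀ {L : CMField} {ι₁ : L →+* ℂ} (V : HermSpace3 L ι₁) (c : SeesawCtx L), ∀ hc : GOG V c,
    slotTypeVec V c (hGR V c) (hGR₀ V c) (hGR₁ V c) (hGR₂ V c) (hGR₃ V c) (hG_GOG V c hc) 3 -
      slotTypeVec V c (hGR V c) (hGR₀ V c) (hGR₁ V c) (hGR₂ V c) (hGR₃ V c) (hG_GOG V c hc) 0 = μ c 3 - μ c 0)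

variable {L : CMField} {ι₁ : L →+* ℂ} (V : HermSpace3 L ι₁) (c : SeesawCtx L) (hc : GOG V c) (hV : IsAnisotropic L V.Hm)

include hc in
/-- **(W-0-SUPPLY) FOR LINES 2, 3 AT THE CONSTRUCTED PIN R2 `SROGT'C`, HYPOTHESIS-FREE UNDER THE GUARD.** -/
theorem hsupply_two_three_ROGT'C :
    ∀ (x₂ x₃ : Fin 3 → FiniteAdeleRing (𝓞 ↥(maximalRealSubfield L)) ↥(maximalRealSubfield L)) (𝔫₂ 𝔫₃ : Ideal (𝓞 ↥(maximalRealSubfield L))),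
      ∃ (B₂ : ArchKTypeDataAt (thetaSpaceInputIn hHD hI h₁ h₃ (SROGT'C @hGR @hGR₀ @hGR₁ @hGR₂ @hGR₃ @μ hΔ₁ hΔ₂ hΔ₃ V c) hV) 2 x₂ 𝔫₂)
        (B₃ : ArchKTypeDataAt (thetaSpaceInputIn hHD hI h₁ h₃ (SROGT'C @hGR @hGR₀ @hGR₁ @hGR₂ @hGR₃ @μ hΔ₁ hΔ₂ hΔ₃ V c) hV) 3 x₃ 𝔫₃),
        B₃.Γ₀ = B₂.Γ₀ ∧
          B₂.Φarch = blockFamilyOfAt (L : Type) e₁ (frameD V) (frameD_real V) (frameD_ne V) (lineVec (L : Type) (dW' c.D 0)) (fun _ => dW'_real c.D 0)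
            (fun _ => dW'_ne c.D 0) ι₁ (blockPosEquiv V) (blockNegEquiv V) (posIdxEquivUnit (hpos_GOG V c hc).2.2.1)
            (negIdxEquivEmpty (hpos_GOG V c hc).2.2.1) (degOnePDual Empty) (binvPi 1) ∧
          B₃.Φarch = blockFamilyOfAt (L : Type) e₁ (frameD V) (frameD_real V) (frameD_ne V) (lineVec (L : Type) (dW' c.D 1)) (fun _ => dW'_real c.D 1)
            (fun _ => dW'_ne c.D 1) ι₁ (blockPosEquiv V) (blockNegEquiv V) (posIdxEquivUnit (hpos_GOG V c hc).2.2.2)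
            (negIdxEquivEmpty (hpos_GOG V c hc).2.2.2) (degOnePDual Empty) (binvPi 1) ∧
          B₂.IsWeaklyPDiff BallForms.expP ∧
          (∀ p : Fin 2, B₂.IsPMinusKilledAlong BallForms.expP (-Complex.I • (Pi.single p 1 : Fin 2 → ℂ))) ∧
          B₃.IsWeaklyPDiff BallForms.expP ∧
          (∀ p : Fin 2, B₃.IsPMinusKilledAlong BallForms.expP (-Complex.I • (Pi.single p 1 : Fin 2 → ℂ))) :=
  hsupply_two_three_of_side_eq hHD hI h₁ h₃ V c (hGR V c) (hGR₀ V c) (hGR₁ V c) (hGR₂ V c) (hGR₃ V c) _ _ _ _ _ _ (hG_GOG V c hc) _ hV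
    hc.1 (hpos_GOG V c hc).2.2.1 (hpos_GOG V c hc).2.2.2
    (continuous_etaT₂ V c.D _ _ (EtaChi.hηc (@χVR @hGR @hGR₀ @hGR₁) (@χWR @hGR @hGR₀ @hGR₁ @μ) V c) (hν'cR @hGR₃ V c))
    (continuous_etaT₃ V c.D _ _ (EtaChi.hηc (@χVR @hGR @hGR₀ @hGR₁) (@χWR @hGR @hGR₀ @hGR₁ @μ) V c) (hν'cR @hGR₃ V c))
    (hdef_two_R2_of_GOG @hGR @hGR₀ @hGR₁ @hGR₂ @hGR₃ (@χWR @hGR @hGR₀ @hGR₁ @μ) V c hc)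
    (hdef_three_R2_of_GOG @hGR @hGR₀ @hGR₁ @hGR₂ @hGR₃ (@χWR @hGR @hGR₀ @hGR₁ @μ) V c hc)
    (hχ_two_R2_of_GOG @hGR @hGR₀ @hGR₁ @hGR₂ @hGR₃ (@χWR @hGR @hGR₀ @hGR₁ @μ) V c hc)
    (hχ_three_R2_of_GOG @hGR @hGR₀ @hGR₁ @hGR₂ @hGR₃ (@χWR @hGR @hGR₀ @hGR₁ @μ) V c hc)
    (SROGT'C @hGR @hGR₀ @hGR₁ @hGR₂ @hGR₃ @μ hΔ₁ hΔ₂ hΔ₃ V c)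
    ((SROGT'C_eq_archSideOfT' @hGR @hGR₀ @hGR₁ @hGR₂ @hGR₃ @μ hΔ₁ hΔ₂ hΔ₃ V c hc).trans
      (archSideOfT'_R2_eq_archSideOfChar @hGR @hGR₀ @hGR₁ @hGR₂ @hGR₃ (@χWR @hGR @hGR₀ @hGR₁ @μ) V c hc _ _ _ _))

end HodgeCM.Model.SInstance

namespace HodgeCM.Model.SInstance

variable (hHD : exists_isReal_hodgeModel) (hI : hodgePQ_independent_of_hodgeModel)
  (h₁ : BallQuotientUniformised)  (h₃ : CMAbelianVarietyRealised)

variable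
  (hGR : ∀ {L : CMField} {ι₁ : L →+* ℂ} (V : HermSpace3 L ι₁) (c : SeesawCtx L),
    (cmSplittingDatum (L : Type) finProdFinEquiv (frameD V) (frameD_real V) (frameD_ne V) (dW c.D) (dW_real c.D)
      (dW_ne c.D)).CompatibleSplitting)
  (hGR₀ : ∀ {L : CMField} {ι₁ : L →+* ℂ} (V : HermSpace3 L ι₁) (c : SeesawCtx L),
    (cmSplittingDatum (L : Type) (ArchSideTerm.e₁) (frameD V) (frameD_real V) (frameD_ne V) (lineVec (L : Type) (dW c.D 0))
      (fun _ => dW_real c.D 0) (fun _ => dW_ne c.D 0)).CompatibleSplitting)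
  (hGR₁ : ∀ {L : CMField} {ι₁ : L →+* ℂ} (V : HermSpace3 L ι₁) (c : SeesawCtx L),
    (cmSplittingDatum (L : Type) (ArchSideTerm.e₁) (frameD V) (frameD_real V) (frameD_ne V) (lineVec (L : Type) (dW c.D 1))
      (fun _ => dW_real c.D 1) (fun _ => dW_ne c.D 1)).CompatibleSplitting)
  (hGR₂ : ∀ {L : CMField} {ι₁ : L →+* ℂ} (V : HermSpace3 L ι₁) (c : SeesawCtx L),
    (cmSplittingDatum (L : Type) (ArchSideTerm.e₁) (frameD V) (frameD_real V) (frameD_ne V) (lineVec (L : Type) (dW' c.D 0))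
      (fun _ => dW'_real c.D 0) (fun _ => dW'_ne c.D 0)).CompatibleSplitting)
  (hGR₃ : ∀ {L : CMField} {ι₁ : L →+* ℂ} (V : HermSpace3 L ι₁) (c : SeesawCtx L),
    (cmSplittingDatum (L : Type) (ArchSideTerm.e₁) (frameD V) (frameD_real V) (frameD_ne V) (lineVec (L : Type) (dW' c.D 1))
      (fun _ => dW'_real c.D 1) (fun _ => dW'_ne c.D 1)).CompatibleSplitting)
  (μ : ∀ {L : CMField}, SeesawCtx L → Fin 4 → NumberField.InfinitePlace (L : Type) → ℤ)

variable {L : CMField} {ι₁ : L →+* ℂ} (V : HermSpace3 L ι₁) (c : SeesawCtx L) (hc : GOG V c) (hV : IsAnisotropic L V.Hm)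

include hc in
/-- **(W-0-SUPPLY) FOR LINES 2, 3 AT THE PIN R2 WITH NO PROVE INPUT `SROGT'CJ`** — hGR×5 [GR91 3.1.1] and `μ` only, HYPOTHESIS-FREE UNDER THE GUARD. -/
theorem hsupply_two_three_ROGT'CJ :
    ∀ (x₂ x₃ : Fin 3 → FiniteAdeleRing (𝓞 ↥(maximalRealSubfield L)) ↥(maximalRealSubfield L)) (𝔫₂ 𝔫₃ : Ideal (𝓞 ↥(maximalRealSubfield L))),
      ∃ (B₂ : ArchKTypeDataAt (thetaSpaceInputIn hHD hI h₁ h₃ (SROGT'CJ @hGR @hGR₀ @hGR₁ @hGR₂ @hGR₃ @μ V c) hV) 2 x₂ 𝔫₂)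
        (B₃ : ArchKTypeDataAt (thetaSpaceInputIn hHD hI h₁ h₃ (SROGT'CJ @hGR @hGR₀ @hGR₁ @hGR₂ @hGR₃ @μ V c) hV) 3 x₃ 𝔫₃),
        B₃.Γ₀ = B₂.Γ₀ ∧
          B₂.Φarch = blockFamilyOfAt (L : Type) e₁ (frameD V) (frameD_real V) (frameD_ne V) (lineVec (L : Type) (dW' c.D 0)) (fun _ => dW'_real c.D 0)
            (fun _ => dW'_ne c.D 0) ι₁ (blockPosEquiv V) (blockNegEquiv V) (posIdxEquivUnit (hpos_GOG V c hc).2.2.1)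
            (negIdxEquivEmpty (hpos_GOG V c hc).2.2.1) (degOnePDual Empty) (binvPi 1) ∧
          B₃.Φarch = blockFamilyOfAt (L : Type) e₁ (frameD V) (frameD_real V) (frameD_ne V) (lineVec (L : Type) (dW' c.D 1)) (fun _ => dW'_real c.D 1)
            (fun _ => dW'_ne c.D 1) ι₁ (blockPosEquiv V) (blockNegEquiv V) (posIdxEquivUnit (hpos_GOG V c hc).2.2.2)
            (negIdxEquivEmpty (hpos_GOG V c hc).2.2.2) (degOnePDual Empty) (binvPi 1) ∧
          B₂.IsWeaklyPDiff BallForms.expP ∧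
          (∀ p : Fin 2, B₂.IsPMinusKilledAlong BallForms.expP (-Complex.I • (Pi.single p 1 : Fin 2 → ℂ))) ∧
          B₃.IsWeaklyPDiff BallForms.expP ∧
          (∀ p : Fin 2, B₃.IsPMinusKilledAlong BallForms.expP (-Complex.I • (Pi.single p 1 : Fin 2 → ℂ))) :=
  hsupply_two_three_ROGT'C hHD hI h₁ h₃ @hGR @hGR₀ @hGR₁ @hGR₂ @hGR₃ (ArchSideTerm.muSharp₂₃ @μ) _ _ _ V c hc hV

end HodgeCM.Model.SInstance

end
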